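import Summits.BirchSwinnertonDyer.BirchSwinnertonDyer.Theorems.TwoAdicConverseBDPSelmerLowerDivisibilityAtTwoPurityAnyPrime
import Literature.NumberTheory.EllipticCurves.Rank1Residual.Predicates
import Mathlib.NumberTheory.NumberField.CMField
import HarnessLib

/-!
# O2 piece P1 PURITY₂ at `p = 2`, BY NAME modulo PRINT: `X_Gr₂(E/K̃_∞)` `Λ₂`-torsion ⟹ no non-zero
# pseudo-null `Λ₂`-submodule, for `E/ℚ` base-changed to an imaginary quadratic `K` with `2 = v v̄` SPLIT
# (helper for stmt-BirchSwinnertonDyer-24728 `BDPSelmerLowerDivisibilityAtTwo`; closes nothing)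

Cell `bsd-2adic`, seat `bsd-2adic-tower-1` GEN 48 — the SUMMON key «PURITY₂» (director-bsd g21 (532)(a); pen
RC-572/573): "Greenberg 2016 Prop. 4.1.1 (c) with `η = v` at `p = 2`, typed from seat 2's `PurityAtTwo` decl"
(node `residual-selmer-control-two` of crux-ideate seat 2 on O2 = stmt-BirchSwinnertonDyer-24728, tree
`Cruxes/BDPSelmerLowerDivisibilityAtTwo/Lines/residual_selmer_control_two.lean`, `ResidualSelmerControlTwo.PurityAtTwo`).

WHAT THIS FILE GIVES (the by-name statement the lead of 19556 / the node should cite):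

* `xGr₂_baseChange_two_hasNoPseudoNullSubmodule_of_printFacts` — for `W/ℚ` elliptic, `K` imaginary quadratic,
  `2 = v·v̄` SPLIT in `K` (`v̄ ≠ v`), any pair of `ℤ₂`-extensions with a generator pair:
  `Module.IsTorsion Λ₂ ((W.baseChange K).XGr₂ 2 κ₁ κ₂ v̄ γ₁ γ₂) → HasNoPseudoNullSubmodule Λ₂ (…same…)`, GRANTED
  ONLY the six PUBLISHED facts by name — Greenberg 2016 Prop. 4.1.1 (`prop411_selmer_isAlmostDivisible`) and
  Prop. 4.2.2 (`prop422_localCohomology_isAlmostDivisible`); Greenberg 2006 §5 A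
  (`sec5A_localH2_subsingleton_of_LOC1`), Prop. 4.1 (`prop41_globalEulerPoincareCorank`), Prop. 4.2
  (`prop42_localEulerPoincareCorank`), Prop. 3.2 (`prop32_cohomology_isCofinitelyGenerated`). It is
  `TwoAdicBDPPurity.xGr₂_hasNoPseudoNullSubmodule_of_facts_anyPrime` (the bsd-ssimc Greenberg road re-run
  parity-free, files `…PurityBridgeAnyPrime` / `…PurityAnyPrime`) at `p := 2`, `W := W.baseChange K`.
* `purityAtTwo_split_of_printFacts` — the same in the BINDER ORDER of seat 2's `PurityAtTwo` (its idle habitat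
  binders `[W.IsGloballyMinimal]`, `¬ W.HasCM`, `GoodOrd W 2`, `¬ W.HasIrreducibleModPGaloisRep 2`, `[IsCMField K]`
  kept, underscore-named) with the split pair DISPLAYED as three extra binders `(v) (hv : 2 ∈ v) (hne : v̄ ≠ v)`
  after `hvbar` — i.e. `PurityAtTwo` restricted to `2` split. On O2's habitat (β) the split binder always holds
  (Heegner hypothesis for `2N`; `GreenbergLowerInclusionAt W K` quantifies exactly `(v vbar) … vbar ≠ v`).

ANSWER TO THE PEN'S RC-573 (which standing hypothesis of Prop. 4.1.1 could fail on (β) rows?): NONE beyond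
torsion. Disjunct (c) ("`∃ η ∈ Σ` with LOC_η⁽¹⁾ and `Q_𝓛(K_η, 𝐃)` coreflexive") carries NO hypothesis on `𝐃[𝔪]` —
the `μ_p`-(sub)quotient clauses are the OTHER disjuncts (a)/(b) (`SelmerGroupStructure.lean` l.631–633) and are
not used; RFX / LOC⁽²⁾ / LOC_v⁽¹⁾ / "`𝓛_v` almost divisible" / clause (c) are KERNEL theorems for
`𝐃 = Ind_{K̃_∞/K} E_K[2^∞]`; and LEO ∧ CRK are DERIVED from `Λ₂`-torsion of `X_Gr₂` by Greenberg's corank identity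
`s_𝓛 = b₁ − q_𝓛 + c_𝓛 + corank Ш²` (`b₁ = q_𝓛 = 2` here; bsd-ssimc `leo_and_crk_fullAt_of_squeeze`) — so no
weak-Leopoldt / Kato input either. Hence on (β): PRINT ∧ TORS₂ ⟹ purity with no row excluded; the finding BN-2
("U forces a non-zero pseudo-null submodule of X_Gr on rows with m₀(red G̃) < e_GL1") is incompatible with
TORS₂ + print there and must be read on the U side (or as a pseudo-null SUBQUOTIENT of the GL(1) dévissage, which
Prop. 4.1.1 does not forbid). NOT COVERED (honest): seat 2's decl also ranges over `2` inert / ramified in `K`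
(outside (β)); there `unrSelmer₂ … v̄` is the everywhere-unramified group, SUR/CRK fail (`corank Q_𝓛 = 4 > 2`) and
Prop. 4.1.1 does not apply — hence the displayed split binder (a `stub-misstated`-type remark, not a refutation).

Theorems only; no definition, no named fact, no instance, no `sorry`. HONEST FRAMING: CONDITIONAL on six PUBLISHED
named facts (hypotheses); closes nothing (`--supports stmt-BirchSwinnertonDyer-24728`); O2 / 19556 / 19218 stay OPEN;
BSD is proved for no curve by this file; typed ≠ proved.

References: [Greenberg2016Selmer] R. Greenberg, *On the structure of Selmer groups*, PROMS 188 (2016), Prop. 4.1.1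
(c) p. 15 L21–32, Prop. 4.2.2 p. 20, §4.3 pp. 20–21, p. 18 L4–16; [Greenberg2006] Doc. Math. Extra Vol. Coates
(2006), Thm. 3 p. 342, Props. 3.2 / 4.1 / 4.2 / 4.3, §5 A, p. 341 L24; [Greenberg2010] Lemma 5.2.2;
[BurungaleCastellaSkinner2025] §2.1 p. 6 (`X_Gr(E/K_∞)`).
-/

-- `Summit.BirchSwinnertonDyer.BirchSwinnertonDyer.…`: summit and sub-problem share a name (D-0017 layout).
set_option linter.dupNamespace false
set_option autoImplicit false

noncomputable section

open scoped Classical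
open NumberField IsDedekindDomain Field
open Literature.NumberTheory.EllipticCurves Literature.NumberTheory.GaloisRepresentations
  Literature.NumberTheory.EllipticCurves.Rank1Residual
  Literature.NumberTheory.IwasawaTheory Literature.NumberTheory.IwasawaTheory.Greenberg2006
  Literature.NumberTheory.IwasawaTheory.Greenberg2016

namespace Summit.BirchSwinnertonDyer.BirchSwinnertonDyer.Theorems.TwoAdicBDPPurity

/-- ★ **P1 PURITY₂ BY NAME, modulo PRINT.** For `W/ℚ` elliptic, `K` imaginary quadratic with `2 = v·v̄` SPLIT
(`v̄ ≠ v`), any `ℤ₂`-extensions `κ₁, κ₂` of `K` with a topological generator pair `(γ₁, γ₂)`: if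
`X_Gr₂ = X_Gr(E/K̃_∞) = ((W.baseChange K).XGr₂ 2 κ₁ κ₂ v̄ γ₁ γ₂)` (unramified at `v̄`, no condition at `v`) is
`Λ₂ = ℤ₂⟦T₁,T₂⟧`-torsion, then it has NO non-zero pseudo-null `Λ₂`-submodule — GRANTED ONLY the six published
facts Greenberg 2016 Props. 4.1.1 / 4.2.2 and Greenberg 2006 Props. 3.2 / 4.1 / 4.2 / §5 A, by name. Greenberg
2016 Prop. 4.1.1 (c) at `η = v`, through the parity-free Shapiro bridge and corank squeeze
(`xGr₂_hasNoPseudoNullSubmodule_of_facts_anyPrime` at `p := 2`).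
[cite: Greenberg2016Selmer, Prop. 4.1.1 (c) (§4.1 p. 15 L21–32), §4.3 pp. 20–21, p. 18 L4–16]
[cite: Greenberg2006, Thm. 3 p. 342; Props. 3.2, 4.1, 4.2, 4.3; §5 A; p. 341 L24] -/
theorem xGr₂_baseChange_two_hasNoPseudoNullSubmodule_of_printFacts
    (h411 : prop411_selmer_isAlmostDivisible) (h422 : prop422_localCohomology_isAlmostDivisible)
    (h5A : sec5A_localH2_subsingleton_of_LOC1) (h41 : prop41_globalEulerPoincareCorank)
    (h42 : prop42_localEulerPoincareCorank) (h32 : prop32_cohomology_isCofinitelyGenerated)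
    (W : WeierstrassCurve ℚ) [W.IsElliptic] {K : Type} [Field K] [NumberField K] (hK : IsImaginaryQuadratic K)
    {v vbar : HeightOneSpectrum (𝓞 K)} (hv : ((2 : ℕ) : 𝓞 K) ∈ v.asIdeal)
    (hvbar : ((2 : ℕ) : 𝓞 K) ∈ vbar.asIdeal) (hne : vbar ≠ v)
    (κ₁ κ₂ : ZpExtension K 2) (γ₁ γ₂ : absoluteGaloisGroup K)
    [Fact (ZpExtension.IsTopGeneratorPair κ₁ κ₂ γ₁ γ₂)]
    (htors : Module.IsTorsion (IwasawaAlgebra₂ 2) ((W.baseChange K).XGr₂ 2 κ₁ κ₂ vbar γ₁ γ₂)) :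
    HasNoPseudoNullSubmodule (IwasawaAlgebra₂ 2) ((W.baseChange K).XGr₂ 2 κ₁ κ₂ vbar γ₁ γ₂) := by
  haveI : (W.baseChange K).IsElliptic := by rw [WeierstrassCurve.baseChange]; infer_instance
  exact xGr₂_hasNoPseudoNullSubmodule_of_facts_anyPrime (W.baseChange K) κ₁ κ₂ vbar γ₁ γ₂ h411 h422 h5A h41
    h42 h32 hK hv hvbar hne htors

/-- The dual reading of ★, unfolded: under the same hypotheses every pseudo-null `Λ₂`-submodule `N` of
`X_Gr(E/K̃_∞)` at `2` is `⊥` (the shape `Rubin1991.thm53_…`'s third conjunct and P2 `LineTorsionFreeAtTwo` consume).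
[cite: Greenberg2016Selmer, §1 p. 2 L31–35, Prop. 4.1.1 (c) p. 15] -/
theorem xGr₂_baseChange_two_eq_bot_of_isPseudoNull_of_printFacts
    (h411 : prop411_selmer_isAlmostDivisible) (h422 : prop422_localCohomology_isAlmostDivisible)
    (h5A : sec5A_localH2_subsingleton_of_LOC1) (h41 : prop41_globalEulerPoincareCorank)
    (h42 : prop42_localEulerPoincareCorank) (h32 : prop32_cohomology_isCofinitelyGenerated)
    (W : WeierstrassCurve ℚ) [W.IsElliptic] {K : Type} [Field K] [NumberField K] (hK : IsImaginaryQuadratic K)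
    {v vbar : HeightOneSpectrum (𝓞 K)} (hv : ((2 : ℕ) : 𝓞 K) ∈ v.asIdeal)
    (hvbar : ((2 : ℕ) : 𝓞 K) ∈ vbar.asIdeal) (hne : vbar ≠ v)
    (κ₁ κ₂ : ZpExtension K 2) (γ₁ γ₂ : absoluteGaloisGroup K)
    [Fact (ZpExtension.IsTopGeneratorPair κ₁ κ₂ γ₁ γ₂)]
    (htors : Module.IsTorsion (IwasawaAlgebra₂ 2) ((W.baseChange K).XGr₂ 2 κ₁ κ₂ vbar γ₁ γ₂))
    (N : Submodule (IwasawaAlgebra₂ 2) ((W.baseChange K).XGr₂ 2 κ₁ κ₂ vbar γ₁ γ₂))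
    (hN : Module.IsPseudoNull (IwasawaAlgebra₂ 2) N) : N = ⊥ :=
  xGr₂_baseChange_two_hasNoPseudoNullSubmodule_of_printFacts h411 h422 h5A h41 h42 h32 W hK hv hvbar hne κ₁ κ₂
    γ₁ γ₂ htors N hN

/-- **`PurityAtTwo` restricted to `2` split, in seat 2's binder order** — for the node
`residual-selmer-control-two` (P1) and the lead of stmt-BirchSwinnertonDyer-19556 to cite by name: the binders of
`ResidualSelmerControlTwo.PurityAtTwo` verbatim (`W`, `[IsElliptic]`, `[IsGloballyMinimal]`, `¬ HasCM`, `GoodOrd W 2`,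
`¬ HasIrreducibleModPGaloisRep 2`, `K`, `[IsCMField K]`, `vbar`, `κ₁ κ₂ γ₁ γ₂`, `[Fact pair]`, `IsImaginaryQuadratic K`,
`2 ∈ vbar`), then the DISPLAYED split pair `(v) (hv : 2 ∈ v) (hne : vbar ≠ v)`, then torsion ⟹ no pseudo-null;
GRANTED the six published facts. The habitat binders are idle (Prop. 4.1.1 (c) needs none of them); the split pair
is load-bearing (for `2` inert/ramified there is no relaxed prime and Prop. 4.1.1 does not apply).
[cite: Greenberg2016Selmer, Prop. 4.1.1 (c) (§4.1 p. 15 L21–32)] [cite: Greenberg2006, Thm. 3 p. 342] -/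
theorem purityAtTwo_split_of_printFacts
    (h411 : prop411_selmer_isAlmostDivisible) (h422 : prop422_localCohomology_isAlmostDivisible)
    (h5A : sec5A_localH2_subsingleton_of_LOC1) (h41 : prop41_globalEulerPoincareCorank)
    (h42 : prop42_localEulerPoincareCorank) (h32 : prop32_cohomology_isCofinitelyGenerated)
    (W : WeierstrassCurve ℚ) [W.IsElliptic] [W.IsGloballyMinimal]
    (_hCM : ¬ W.HasCM) (_hord : GoodOrd W 2) (_hred : ¬ W.HasIrreducibleModPGaloisRep 2)
    (K : Type) [Field K] [NumberField K] [IsCMField K] (vbar : HeightOneSpectrum (𝓞 K))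
    (κ₁ κ₂ : ZpExtension K 2) (γ₁ γ₂ : absoluteGaloisGroup K)
    [Fact (ZpExtension.IsTopGeneratorPair κ₁ κ₂ γ₁ γ₂)]
    (hK : IsImaginaryQuadratic K) (hvbar : ((2 : ℕ) : 𝓞 K) ∈ vbar.asIdeal)
    -- the displayed split pair (habitat (β): Heegner for `2N` ⟹ `2 = v v̄` split)
    (v : HeightOneSpectrum (𝓞 K)) (hv : ((2 : ℕ) : 𝓞 K) ∈ v.asIdeal) (hne : vbar ≠ v)
    (htors : Module.IsTorsion (IwasawaAlgebra₂ 2) ((W.baseChange K).XGr₂ 2 κ₁ κ₂ vbar γ₁ γ₂)) :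
    HasNoPseudoNullSubmodule (IwasawaAlgebra₂ 2) ((W.baseChange K).XGr₂ 2 κ₁ κ₂ vbar γ₁ γ₂) :=
  xGr₂_baseChange_two_hasNoPseudoNullSubmodule_of_printFacts h411 h422 h5A h41 h42 h32 W hK hv hvbar hne κ₁ κ₂
    γ₁ γ₂ htors

end Summit.BirchSwinnertonDyer.BirchSwinnertonDyer.Theorems.TwoAdicBDPPurity

end
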